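import Summits.Ventures.PercRepro.S1FourCircuitCount

/-!
# PercRepro — THE CIRCUIT LADDER AT BOUNDED NULLITY, PART A (the base and the rungs `2`, `3` and the `4`-circuits through a point): `2·s₂ ≤ a·ν`, `4·s₃ ≤ a·ν(ν+1)`, `12·s₄ ≤ a·ν(ν+1)(ν+2)`,
`48·s₅ ≤ a·ν(ν+1)(ν+2)(ν+3)` under a flat bound ONE RANK BELOW (p8, gen 18; a feeder for S4 — the top of the `q = 7` window)

p2 g14's LEMMAS T and T4 (`two_mul_ncard_triangles_le`, `three_mul_ncard_four_circuits_le`) with the point bounds as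
PARAMETERS: if every set of rank `≤ k − 1` has at most `a + (k − 2)` points and `|E| = r(E) + ν`, then the `k`-element
circuits number at most `a·ν(ν+1)⋯(ν+k−2)/(k−1)!` — for `k = 2, 3, 4, 5`. The proof is p2's, one rung per size: the
`k`-circuits through a non-loop `e` inject (`C ↦ C ∖ {e}`) into the `(k − 1)`-circuits of `M ／ {e}`, whose rank-`≤ k − 2`
sets have at most `a + (k − 3)` points (one point fewer than the rank-`≤ k − 1` sets of `M` through `e`), and the
`k`-circuits avoiding `e` are those of `M ＼ {e}` (nullity `ν − 1`); the base is the parallel-pair count (a class of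
`c + 1 ≤ a` points carries `C(c + 1, 2) ≤ a·c/2` pairs and `c` of the nullity).
At level `7` the `e`-free core has rank-`4` sets of `≤ 10` points, so `48·s₅ ≤ 7·ν(ν+1)(ν+2)(ν+3)` (LEMMA T5) — against
`s₅ ≤ C(ν + 4, 5)`: `206 168` against `435 897` at `ν = 33`, the cell `(70, 33)` of the quartic chain.
* **`two_mul_ncard_two_circuits_le`** (rank-`1` sets `≤ a`) · **`two_mul_ncard_trianglesThrough_le`**,
  **`four_mul_ncard_triangles_le`** (rank-`2` sets `≤ a + 1`) · **`four_mul_ncard_fourThrough_le`**,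
  **`twelve_mul_ncard_four_circuits_le`** (rank-`3` sets `≤ a + 2`) · **`twelve_mul_ncard_fiveThrough_le`**,
  **`fortyEight_mul_ncard_five_circuits_le`** (rank-`4` sets `≤ a + 3`).
Axioms: standard.
-/

open scoped Matroid

namespace PercRepro

namespace S1

open Set

variable {α : Type}

/-- **The parallel-pair count with the class bound as a parameter**: if `|E| = r(E) + d` and every set of rank `≤ 1`
has at most `a` points, then `2·#(2-circuits) ≤ a·d`. -/
theorem two_mul_ncard_two_circuits_le (K : Matroid α) [K.Finite] (a : ℕ)
    (h1 : ∀ L ⊆ K.E, K.eRk L ≤ 1 → L.ncard ≤ a) {d : ℕ} (hd : K.E.encard = K.eRank + d) :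
    2 * {C : Set α | K.IsCircuit C ∧ C.ncard = 2}.ncard ≤ a * d := by
  suffices H : ∀ n : ℕ, ∀ (K : Matroid α) [K.Finite], K.E.ncard = n →
      (∀ L ⊆ K.E, K.eRk L ≤ 1 → L.ncard ≤ a) → ∀ d : ℕ, K.E.encard = K.eRank + d →
      2 * {C : Set α | K.IsCircuit C ∧ C.ncard = 2}.ncard ≤ a * d from H _ K rfl h1 d hd
  intro n
  induction n using Nat.strong_induction_on with
  | _ n ih =>
  intro K _ hn h1 d hd
  classical
  set S := {C : Set α | K.IsCircuit C ∧ C.ncard = 2} with hS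
  have hSfin : S.Finite :=
    K.ground_finite.finite_subsets.subset (fun C hC => hC.1.subset_ground)
  by_cases hSe : S = ∅
  · rw [hSe, ncard_empty]; exact Nat.zero_le _
  obtain ⟨C₀, hC₀⟩ := nonempty_iff_ne_empty.2 hSe
  obtain ⟨a₀, b, hab, hC₀ab⟩ := ncard_eq_two.1 hC₀.2
  have haC₀ : a₀ ∈ C₀ := by rw [hC₀ab]; exact mem_insert a₀ {b}
  have hbC₀ : b ∈ C₀ := by rw [hC₀ab]; exact mem_insert_of_mem a₀ rfl
  have haE : a₀ ∈ K.E := hC₀.1.subset_ground haC₀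
  have hanl : K.IsNonloop a₀ := by
    refine Matroid.isNonloop_of_not_isLoop haE ?_
    intro hloop
    have h := hloop.eq_of_isCircuit_mem hC₀.1 haC₀
    have h2 := hC₀.2
    rw [h, ncard_singleton] at h2
    omega
  have hrfin : K.eRank ≠ ⊤ := PercRepro.Matroid.eRank_ne_top_of_finite K
  obtain ⟨r, hr⟩ := ENat.ne_top_iff_exists.1 hrfin
  have hEn : K.E.ncard = r + d := by
    have h := hd
    rw [← hr, ← K.ground_finite.cast_ncard_eq] at h
    exact_mod_cast h
  set P := K.closure {a₀} with hP
  have hPE : P ⊆ K.E := K.closure_subset_ground _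
  have hPfin : P.Finite := K.ground_finite.subset hPE
  have haP : a₀ ∈ P := K.mem_closure_self a₀ haE
  have hPr : K.eRk P ≤ 1 := by
    rw [hP, K.eRk_closure_eq, hanl.eRk_eq]
  have hPcard : P.ncard ≤ a := h1 P hPE hPr
  set D := P \ {a₀} with hD
  have hDP : D ⊆ P := sdiff_subset
  have haD : a₀ ∉ D := fun h => h.2 rfl
  have hDE : D ⊆ K.E := hDP.trans hPE
  have hDfin : D.Finite := hPfin.subset hDP
  have hbP : b ∈ P := by
    have h := hC₀.1.mem_closure_sdiff_singleton_of_mem hbC₀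
    have h2 : C₀ \ {b} = {a₀} := by rw [hC₀ab, pair_sdiff_right hab]
    rw [h2] at h
    exact h
  have hbD : b ∈ D := ⟨hbP, fun h => hab (mem_singleton_iff.1 h).symm⟩
  have hDne : D.Nonempty := ⟨b, hbD⟩
  set m := D.ncard with hm
  have hm1 : 1 ≤ m := by
    rw [hm]; exact Nat.one_le_iff_ne_zero.2 (by rw [Ne, ncard_eq_zero hDfin]; exact hDne.ne_empty)
  have hPm : P.ncard = m + 1 := by
    rw [hm, hD, ncard_sdiff_singleton_add_one haP hPfin]
  have hma : m + 1 ≤ a := by omega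
  set K' := K ＼ D with hK'
  have hK'rank : K'.eRank = K.eRank := eRank_delete_eq_of_subset_closure K haE haD hDP
  have hK'E : K'.E = K.E \ D := Matroid.delete_ground K D
  have hK'card : K'.E.ncard + m = K.E.ncard := by
    rw [hK'E, hm]
    have h := encard_sdiff_add_encard_of_subset hDE
    rw [← (K.ground_finite.subset sdiff_subset).cast_ncard_eq, ← hDfin.cast_ncard_eq,
      ← K.ground_finite.cast_ncard_eq] at h
    exact_mod_cast h
  have hK'lt : K'.E.ncard < n := by rw [← hn]; omega
  have hmd : m ≤ d := by
    have h := K'.eRk_le_encard K'.E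
    rw [← Matroid.eRank_def, hK'rank, ← hr, ← (K.ground_finite.subset (hK'E ▸ sdiff_subset)).cast_ncard_eq] at h
    have h' : r ≤ K'.E.ncard := by exact_mod_cast h
    omega
  have hd' : K'.E.encard = K'.eRank + ((d - m : ℕ) : ℕ∞) := by
    rw [hK'rank, ← hr, ← (K.ground_finite.subset (hK'E ▸ sdiff_subset)).cast_ncard_eq]
    have : K'.E.ncard = r + (d - m) := by omega
    rw [this]; push_cast; rfl
  have h1' : ∀ L ⊆ K'.E, K'.eRk L ≤ 1 → L.ncard ≤ a := by
    intro L hL hr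
    rw [hK'E] at hL
    rw [hK', Matroid.delete_eq_restrict, Matroid.restrict_eRk_eq _ hL] at hr
    exact h1 L (hL.trans sdiff_subset) hr
  set S₁ := {C : Set α | C ⊆ P ∧ C.ncard = 2} with hS₁
  set S₂ := {C : Set α | K'.IsCircuit C ∧ C.ncard = 2} with hS₂
  have hsplit : S ⊆ S₁ ∪ S₂ := by
    intro C hC
    by_cases hCD : Disjoint C D
    · exact Or.inr ⟨Matroid.delete_isCircuit_iff.2 ⟨hC.1, hCD⟩, hC.2⟩
    · left
      refine ⟨?_, hC.2⟩
      obtain ⟨u, huC, huD⟩ := not_disjoint_iff.1 hCD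
      have huP : u ∈ P := hDP huD
      have hCfin : C.Finite := K.ground_finite.subset hC.1.subset_ground
      have hunl : K.IsNonloop u := by
        refine Matroid.isNonloop_of_not_isLoop (hC.1.subset_ground huC) ?_
        intro hloop
        have h := hloop.eq_of_isCircuit_mem hC.1 huC
        have h2 := hC.2
        rw [h, ncard_singleton] at h2
        omega
      have hcl : K.closure {u} = K.closure {a₀} := hunl.closure_eq_of_mem_closure huP
      intro v hvC
      by_cases hvu : v = u
      · rw [hvu]; exact huP
      · have hv : v ∈ K.closure (C \ {v}) := hC.1.mem_closure_sdiff_singleton_of_mem hvC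
        have hCuv : ({u, v} : Set α) ⊆ C := insert_subset_iff.2 ⟨huC, singleton_subset_iff.2 hvC⟩
        have hCeq : C = {u, v} :=
          (eq_of_subset_of_ncard_le hCuv (by rw [hC.2, ncard_pair (Ne.symm hvu)]) hCfin).symm
        have hCv : C \ {v} = {u} := by rw [hCeq, pair_sdiff_right (Ne.symm hvu)]
        rw [hCv, hcl] at hv
        exact hv
  have hS₁fin : S₁.Finite := hPfin.finite_subsets.subset (fun C hC => hC.1)
  have hS₂fin : S₂.Finite := K'.ground_finite.finite_subsets.subset (fun C hC => hC.1.subset_ground)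
  have hS₁card : S₁.ncard ≤ (m + 1).choose 2 := by
    have hsub : S₁ ⊆ ((hPfin.toFinset.powersetCard 2).image (fun t : Finset α => (t : Set α)) : Set (Set α)) := by
      intro C hC
      have hCfin : C.Finite := hPfin.subset hC.1
      rw [Finset.coe_image]
      refine ⟨hCfin.toFinset, ?_, by simp⟩
      rw [Finset.mem_coe, Finset.mem_powersetCard]
      refine ⟨?_, ?_⟩
      · intro x hx
        rw [Finite.mem_toFinset] at hx ⊢
        exact hC.1 hx
      · rw [← ncard_eq_toFinset_card C hCfin]; exact hC.2
    calc S₁.ncard ≤ ((hPfin.toFinset.powersetCard 2).image (fun t : Finset α => (t : Set α)) : Set (Set α)).ncard :=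
          ncard_le_ncard hsub (Finset.finite_toSet _)
      _ = ((hPfin.toFinset.powersetCard 2).image (fun t : Finset α => (t : Set α))).card := ncard_coe_finset _
      _ ≤ (hPfin.toFinset.powersetCard 2).card := Finset.card_image_le
      _ = (m + 1).choose 2 := by
          rw [Finset.card_powersetCard, ← hPm, ncard_eq_toFinset_card P hPfin]
  have hS₂card : 2 * S₂.ncard ≤ a * (d - m) := ih _ hK'lt K' rfl h1' (d - m) hd'
  -- `2·C(m + 1, 2) = (m + 1)·m ≤ a·m`
  have hchoose : 2 * (m + 1).choose 2 ≤ a * m := by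
    have h := Nat.choose_two_right (m + 1)
    rw [h, show m + 1 - 1 = m by omega]
    have h2 : (m + 1) * m / 2 * 2 = (m + 1) * m := by
      apply Nat.div_mul_cancel
      rw [mul_comm]
      exact (Nat.even_mul_succ_self m).two_dvd
    calc 2 * ((m + 1) * m / 2) = (m + 1) * m := by rw [mul_comm]; exact h2
      _ ≤ a * m := Nat.mul_le_mul_right m hma
  have hSS : S.ncard ≤ S₁.ncard + S₂.ncard :=
    (ncard_le_ncard hsplit (hS₁fin.union hS₂fin)).trans (ncard_union_le _ _)
  calc 2 * S.ncard ≤ 2 * S₁.ncard + 2 * S₂.ncard := by omega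
    _ ≤ 2 * (m + 1).choose 2 + a * (d - m) := by omega
    _ ≤ a * m + a * (d - m) := by omega
    _ = a * d := by rw [← Nat.mul_add, Nat.add_sub_cancel' hmd]

/-- **The `3`-circuits through a point, the rank-`2` sets with `≤ a + 1` points**: `2·#{3-circuits through e} ≤ a * d` —
they inject (`C ↦ C ∖ {e}`) into the `2`-circuits of `M ／ {e}`, whose rank-`≤ 1` sets have `≤ a + 0` points (the parallel-pair count). -/
theorem two_mul_ncard_trianglesThrough_le (M : Matroid α) [M.Finite] (a : ℕ)
    (hflat : ∀ X ⊆ M.E, M.eRk X ≤ 2 → X.ncard ≤ a + 1) {e : α} (heI : M.Indep {e}) {d : ℕ}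
    (hd : M.E.encard = M.eRank + d) :
    2 * {C : Set α | M.IsCircuit C ∧ C.ncard = 3 ∧ e ∈ C}.ncard ≤ a * d := by
  classical
  have heE : e ∈ M.E := heI.subset_ground (mem_singleton e)
  have hν : M✶.eRank = (d : ℕ∞) := dual_eRank_eq_of_encard M hd
  set N := M ／ {e} with hN
  have hNd : N.E.encard = N.eRank + d := by
    apply encard_eq_of_dual_eRank
    rw [hN, PercRepro.Matroid.dual_eRank_contract_singleton heI, hν]
  have hNE : N.E = M.E \ {e} := _root_.Matroid.contract_ground M {e}
  have hN' : ∀ L ⊆ N.E, N.eRk L ≤ 1 → L.ncard ≤ a + 0 := by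
    intro L hL hr
    rw [hNE] at hL
    have heL : e ∉ L := fun h => (hL h).2 rfl
    have hLfin : L.Finite := M.ground_finite.subset (hL.trans sdiff_subset)
    have hins : M.eRk (insert e L) ≤ 2 := by
      have h := contract_singleton_eRk_add_one heI hL
      rw [← hN] at h
      rw [← h]
      calc N.eRk L + 1 ≤ 1 + 1 := add_le_add_left hr 1
        _ = 2 := by norm_num
    have hb := hflat (insert e L) (insert_subset heE (hL.trans sdiff_subset)) hins
    rw [ncard_insert_of_notMem heL hLfin] at hb
    omega
  set S₁ := {C : Set α | M.IsCircuit C ∧ C.ncard = 3 ∧ e ∈ C} with hS₁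
  let f : Set α → Set α := fun C => C \ {e}
  have hmaps : ∀ C ∈ S₁, f C ∈ {C' : Set α | N.IsCircuit C' ∧ C'.ncard = 2} := by
    intro C hC
    have hCfin : C.Finite := M.ground_finite.subset hC.1.subset_ground
    refine ⟨hC.1.contractElem_isCircuit ?_ hC.2.2, ?_⟩
    · have h1lt : 1 < C.ncard := by rw [hC.2.1]; omega
      obtain ⟨x, hx, y, hy, hxy⟩ := (one_lt_ncard hCfin).1 h1lt
      exact ⟨x, hx, y, hy, hxy⟩
    · have h3 := ncard_sdiff_singleton_add_one hC.2.2 hCfin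
      have h4 := hC.2.1
      simp only [f]
      omega
  have hinj : InjOn f S₁ := by
    intro C hC C' hC' h
    have e1 : C = insert e (C \ {e}) := by rw [insert_sdiff_singleton, insert_eq_of_mem hC.2.2]
    have e2 : C' = insert e (C' \ {e}) := by rw [insert_sdiff_singleton, insert_eq_of_mem hC'.2.2]
    rw [e1, e2]
    simp only [f] at h
    rw [h]
  have hle : S₁.ncard ≤ {C' : Set α | N.IsCircuit C' ∧ C'.ncard = 2}.ncard :=
    ncard_le_ncard_of_injOn f hmaps hinj
      (N.ground_finite.finite_subsets.subset (fun C hC => hC.1.subset_ground))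
  have hinner := two_mul_ncard_two_circuits_le N a hN' hNd
  calc 2 * S₁.ncard ≤ 2 * {C' : Set α | N.IsCircuit C' ∧ C'.ncard = 2}.ncard := Nat.mul_le_mul_left _ hle
    _ ≤ a * d := hinner

/-- **The `3`-circuit count at bounded nullity, the rank-`2` sets with `≤ a + 1` points**: `4·s_3 ≤ a * d * (d + 1)`
(the deletion induction of Lemma T: the `3`-circuits through a point `e` by `two_mul_ncard_trianglesThrough_le`, the others are the
`3`-circuits of `M ＼ {e}`). -/
theorem four_mul_ncard_triangles_le (M : Matroid α) [M.Finite] (a : ℕ)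
    (hflat : ∀ X ⊆ M.E, M.eRk X ≤ 2 → X.ncard ≤ a + 1) {d : ℕ} (hd : M.E.encard = M.eRank + d) :
    4 * {C : Set α | M.IsCircuit C ∧ C.ncard = 3}.ncard ≤ a * d * (d + 1) := by
  suffices H : ∀ n : ℕ, ∀ (M : Matroid α) [M.Finite], M.E.ncard = n →
      (∀ X ⊆ M.E, M.eRk X ≤ 2 → X.ncard ≤ a + 1) → ∀ d : ℕ, M.E.encard = M.eRank + d →
      4 * {C : Set α | M.IsCircuit C ∧ C.ncard = 3}.ncard ≤ a * d * (d + 1) from H _ M rfl hflat d hd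
  intro n
  induction n using Nat.strong_induction_on with
  | _ n ih =>
  intro M _ hn hflat d hd
  classical
  set S := {C : Set α | M.IsCircuit C ∧ C.ncard = 3} with hS
  have hSfin : S.Finite :=
    M.ground_finite.finite_subsets.subset (fun C hC => hC.1.subset_ground)
  by_cases hSe : S = ∅
  · rw [hSe, ncard_empty]; exact Nat.zero_le _
  obtain ⟨C₀, hC₀⟩ := nonempty_iff_ne_empty.2 hSe
  obtain ⟨e, heC₀⟩ := hC₀.1.nonempty
  have heE : e ∈ M.E := hC₀.1.subset_ground heC₀
  have hne : ¬ M.IsColoop e := hC₀.1.not_isColoop_of_mem heC₀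
  have hν : M✶.eRank = (d : ℕ∞) := dual_eRank_eq_of_encard M hd
  have hdel := PercRepro.Matroid.dual_eRank_delete_singleton_add_one heE hne
  rw [hν] at hdel
  have hfin' : (M ＼ {e})✶.eRank ≠ ⊤ := by
    intro h
    rw [h] at hdel
    exact absurd hdel (by simp)
  obtain ⟨d', hd'⟩ := ENat.ne_top_iff_exists.1 hfin'
  have hdd' : d = d' + 1 := by
    rw [← hd'] at hdel
    exact_mod_cast hdel.symm
  have hd'enc : (M ＼ {e}).E.encard = (M ＼ {e}).eRank + d' := encard_eq_of_dual_eRank _ hd'.symm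
  have hdelE : (M ＼ {e}).E.ncard < n := by
    rw [_root_.Matroid.delete_ground, ← hn, ← ncard_sdiff_singleton_add_one heE M.ground_finite]
    omega
  have hflat' : ∀ X ⊆ (M ＼ {e}).E, (M ＼ {e}).eRk X ≤ 2 → X.ncard ≤ a + 1 := by
    intro X hX hr
    rw [_root_.Matroid.delete_ground] at hX
    rw [delete_singleton_eRk_eq hX] at hr
    exact hflat X (hX.trans sdiff_subset) hr
  have heI : M.Indep {e} := by
    rw [_root_.Matroid.indep_singleton, ← _root_.Matroid.not_isLoop_iff heE]
    intro hloop
    have hC₀e : C₀ = {e} := hloop.eq_of_isCircuit_mem hC₀.1 heC₀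
    have := hC₀.2
    rw [hC₀e, ncard_singleton] at this
    omega
  set S₁ := {C : Set α | M.IsCircuit C ∧ C.ncard = 3 ∧ e ∈ C} with hS₁
  set S₂ := {C : Set α | M.IsCircuit C ∧ C.ncard = 3 ∧ e ∉ C} with hS₂
  have hsplit : S ⊆ S₁ ∪ S₂ := by
    intro C hC
    by_cases h : e ∈ C
    · exact Or.inl ⟨hC.1, hC.2, h⟩
    · exact Or.inr ⟨hC.1, hC.2, h⟩
  have hS₁fin : S₁.Finite := hSfin.subset (fun C hC => ⟨hC.1, hC.2.1⟩)
  have hS₂fin : S₂.Finite := hSfin.subset (fun C hC => ⟨hC.1, hC.2.1⟩)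
  have h1 : 2 * S₁.ncard ≤ a * d := two_mul_ncard_trianglesThrough_le M a hflat heI hd
  have h2c : 4 * S₂.ncard ≤ a * d' * (d' + 1) := by
    have hsub : S₂ ⊆ {C : Set α | (M ＼ {e}).IsCircuit C ∧ C.ncard = 3} := by
      intro C hC
      exact ⟨_root_.Matroid.delete_isCircuit_iff.2 ⟨hC.1, disjoint_singleton_right.2 hC.2.2⟩, hC.2.1⟩
    calc 4 * S₂.ncard ≤ 4 * {C : Set α | (M ＼ {e}).IsCircuit C ∧ C.ncard = 3}.ncard := by
          apply Nat.mul_le_mul_left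
          exact ncard_le_ncard hsub
            ((M ＼ {e}).ground_finite.finite_subsets.subset (fun C hC => hC.1.subset_ground))
      _ ≤ _ := ih _ hdelE (M ＼ {e}) rfl hflat' d' hd'enc
  have h3 : S.ncard ≤ S₁.ncard + S₂.ncard :=
    (ncard_le_ncard hsplit (hS₁fin.union hS₂fin)).trans (ncard_union_le _ _)
  subst hdd'
  nlinarith [h1, h2c, h3]

/-- **The `4`-circuits through a point, the rank-`3` sets with `≤ a + 2` points**: `4·#{4-circuits through e} ≤ a * d * (d + 1)` —
they inject (`C ↦ C ∖ {e}`) into the `3`-circuits of `M ／ {e}`, whose rank-`≤ 2` sets have `≤ a + 1` points (the triangle count one rung down). -/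
theorem four_mul_ncard_fourThrough_le (M : Matroid α) [M.Finite] (a : ℕ)
    (hflat : ∀ X ⊆ M.E, M.eRk X ≤ 3 → X.ncard ≤ a + 2) {e : α} (heI : M.Indep {e}) {d : ℕ}
    (hd : M.E.encard = M.eRank + d) :
    4 * {C : Set α | M.IsCircuit C ∧ C.ncard = 4 ∧ e ∈ C}.ncard ≤ a * d * (d + 1) := by
  classical
  have heE : e ∈ M.E := heI.subset_ground (mem_singleton e)
  have hν : M✶.eRank = (d : ℕ∞) := dual_eRank_eq_of_encard M hd
  set N := M ／ {e} with hN
  have hNd : N.E.encard = N.eRank + d := by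
    apply encard_eq_of_dual_eRank
    rw [hN, PercRepro.Matroid.dual_eRank_contract_singleton heI, hν]
  have hNE : N.E = M.E \ {e} := _root_.Matroid.contract_ground M {e}
  have hN' : ∀ L ⊆ N.E, N.eRk L ≤ 2 → L.ncard ≤ a + 1 := by
    intro L hL hr
    rw [hNE] at hL
    have heL : e ∉ L := fun h => (hL h).2 rfl
    have hLfin : L.Finite := M.ground_finite.subset (hL.trans sdiff_subset)
    have hins : M.eRk (insert e L) ≤ 3 := by
      have h := contract_singleton_eRk_add_one heI hL
      rw [← hN] at h
      rw [← h]
      calc N.eRk L + 1 ≤ 2 + 1 := add_le_add_left hr 1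
        _ = 3 := by norm_num
    have hb := hflat (insert e L) (insert_subset heE (hL.trans sdiff_subset)) hins
    rw [ncard_insert_of_notMem heL hLfin] at hb
    omega
  set S₁ := {C : Set α | M.IsCircuit C ∧ C.ncard = 4 ∧ e ∈ C} with hS₁
  let f : Set α → Set α := fun C => C \ {e}
  have hmaps : ∀ C ∈ S₁, f C ∈ {C' : Set α | N.IsCircuit C' ∧ C'.ncard = 3} := by
    intro C hC
    have hCfin : C.Finite := M.ground_finite.subset hC.1.subset_ground
    refine ⟨hC.1.contractElem_isCircuit ?_ hC.2.2, ?_⟩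
    · have h1lt : 1 < C.ncard := by rw [hC.2.1]; omega
      obtain ⟨x, hx, y, hy, hxy⟩ := (one_lt_ncard hCfin).1 h1lt
      exact ⟨x, hx, y, hy, hxy⟩
    · have h3 := ncard_sdiff_singleton_add_one hC.2.2 hCfin
      have h4 := hC.2.1
      simp only [f]
      omega
  have hinj : InjOn f S₁ := by
    intro C hC C' hC' h
    have e1 : C = insert e (C \ {e}) := by rw [insert_sdiff_singleton, insert_eq_of_mem hC.2.2]
    have e2 : C' = insert e (C' \ {e}) := by rw [insert_sdiff_singleton, insert_eq_of_mem hC'.2.2]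
    rw [e1, e2]
    simp only [f] at h
    rw [h]
  have hle : S₁.ncard ≤ {C' : Set α | N.IsCircuit C' ∧ C'.ncard = 3}.ncard :=
    ncard_le_ncard_of_injOn f hmaps hinj
      (N.ground_finite.finite_subsets.subset (fun C hC => hC.1.subset_ground))
  have hinner := four_mul_ncard_triangles_le N a hN' hNd
  calc 4 * S₁.ncard ≤ 4 * {C' : Set α | N.IsCircuit C' ∧ C'.ncard = 3}.ncard := Nat.mul_le_mul_left _ hle
    _ ≤ a * d * (d + 1) := hinner


end S1

end PercRepro
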